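import Mathlib.Topology.Algebra.OpenSubgroup
import Literature.AnabelianGeometry.SemiGraphs.SubgroupPresentationCosetGraph
import HarnessLib

/-!
# [SemiAnbd] Thm 5.4 (i) p. 66, producer T54-B: the arithmetic cofinality binder `hcof` ⟺ pro-faithfulness
# of `Π_A` on the tower of level graphs (T54·hcof)

Mochizuki, *Semi-graphs of anabelioids*, Publ. RIMS **42** (2006), §5: Def. 5.1 (i) p. 62 (the action of
`π₁(A)` on `𝒢` and its finite étale coverings; (c): an open subgroup acts trivially on the underlying
semi-graph), Prop. 5.2 (iv) p. 64 (`1 → Π^temp_𝒢 → Π^temp_𝔊 → Π_A → 1`) and the proof of Thm. 5.4 (i) p. 66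
("entirely parallel" to Thm. 3.7 (iii): the compact subgroup acts on the finite semi-graphs of the tower)
[cite: MochizukiSemiAnbd2006, Thm 5.4 (i) p.66].

PROOF-ONLY, pure topological group theory (cell row T54-B, producer debt `HOME/plan/GAP-LEDGER.md`
G-w4d053-1; binder `hcof` of abc-iut-w4-d029's `augQ_eq_one_of_forall_qAct_eq_one` /
`iInf_ker_qAct_eq_bot` (`CompactCompletionFaithful.lean`) and of abc-iut-w4-d059's (AI4″) producer):
`hcof : ∀ U ∈ 𝓝 (1 : Π_A), ∃ j, ∀ e ∈ ker (levelAct j), aug e ∈ U` — "the images in `Π_A` of the level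
kernels shrink to `1`".  This file shows WHAT `hcof` IS:

* `cofinal_map_of_nhds_basis` — it HOLDS as soon as the level kernels form a neighbourhood basis of `1`
  in `E` and `aug` is continuous;
* `cofinal_map_of_forall_mem_map_imp_eq_one` — for COMPACT `Π_A`, closed images and a directed family, it
  holds as soon as the images meet in `1` (`hfaith`, Cantor intersection); conversely
  `forall_mem_map_imp_eq_one_of_cofinal_map` — it IMPLIES that the images meet in `1` (`Π_A` T₁).  So,
  under the capstone's side conditions (open level kernels, `aug` open, `Π_A` profinite), `hcof` is
  EQUIVALENT to `hfaith : ⋂_j aug (ker levelAct j) = 1`: "`Π_A` acts PRO-FAITHFULLY on the tower of level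
  graphs — no `a ≠ 1` admits, at every level, a lift acting trivially on that level's semi-graph";
* `isClosed_map_of_isOpen` — the images of open level kernels under an open `aug` are (open, hence) closed;
* `hcof_of_faithful_levels` — abc-iut-w4-d029's binder text VERBATIM from `hfaith` + open kernels + `aug`
  open + `Π_A` compact; `faithful_levels_of_hcof` — the converse.

HONEST RESIDUAL: `hfaith` is NOT derivable from the tower data (counter-shape: a one-vertex edgeless `𝒢`
has one-point level graphs, every `ker levelAct j = E`, and then `hcof ⟺ Π_A = 1`); it is an input on the
arithmetic action, carried by the capstone as a NAMED binder (no `Prop` definition, no FACT-LIST row).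
Nothing here refers to the IUT corpus; no side is taken on [IUTchIII] Cor 3.12; typed ≠ proved.
-/

namespace Literature.AnabelianGeometry.SemiGraphs

open Topology Filter

universe u v w

section Generic

variable {E : Type u} [Group E] {PA : Type v} [Group PA] [TopologicalSpace PA]
  (aug : E →* PA) {J : Type w} (K : J → Subgroup E)

/-- **`hcof` from a neighbourhood basis**: if the subgroups `K j` form a neighbourhood (sub)basis of `1`
in `E` and `aug` is continuous, their images shrink to `1` in `Π_A`.
[cite: MochizukiSemiAnbd2006, Thm 5.4 (i) p.66] -/
theorem cofinal_map_of_nhds_basis [TopologicalSpace E] (haug : Continuous aug)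
    (hbasis : ∀ V ∈ 𝓝 (1 : E), ∃ j, (K j : Set E) ⊆ V) :
    ∀ U ∈ 𝓝 (1 : PA), ∃ j, ∀ e ∈ K j, aug e ∈ U := by
  intro U hU
  have hV : aug ⁻¹' U ∈ 𝓝 (1 : E) := by
    refine haug.continuousAt.preimage_mem_nhds ?_
    rwa [map_one]
  obtain ⟨j, hj⟩ := hbasis _ hV
  exact ⟨j, fun e he => hj he⟩

/-- **`hcof` from pro-faithfulness, for compact `Π_A`** (Cantor intersection): if the images
`aug (K j)` are closed, directed downward, and meet in `1` (`hfaith`), then they shrink to `1`: every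
neighbourhood of `1` contains one of them. [cite: MochizukiSemiAnbd2006, Thm 5.4 (i) p.66] -/
theorem cofinal_map_of_forall_mem_map_imp_eq_one [CompactSpace PA] [Nonempty J]
    (hdir : ∀ i j, ∃ k, K k ≤ K i ∧ K k ≤ K j)
    (hclosed : ∀ j, IsClosed ((K j).map aug : Set PA))
    (hfaith : ∀ a : PA, (∀ j, a ∈ (K j).map aug) → a = 1) :
    ∀ U ∈ 𝓝 (1 : PA), ∃ j, ∀ e ∈ K j, aug e ∈ U := by
  intro U hU
  obtain ⟨V, hVU, hVo, h1V⟩ := mem_nhds_iff.mp hU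
  -- the compact closed sets `aug (K j) \ V`, directed downward, meet in `∅`
  let F : J → Set PA := fun j => ((K j).map aug : Set PA) ∩ Vᶜ
  have hFc : ∀ j, IsCompact (F j) := fun j => ((hclosed j).inter hVo.isClosed_compl).isCompact
  have hFcl : ∀ j, IsClosed (F j) := fun j => (hclosed j).inter hVo.isClosed_compl
  have hFdir : Directed (· ⊇ ·) F := by
    intro i j
    obtain ⟨k, hki, hkj⟩ := hdir i j
    exact ⟨k, Set.inter_subset_inter_left _ (Subgroup.map_mono hki),
      Set.inter_subset_inter_left _ (Subgroup.map_mono hkj)⟩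
  have hFempty : ⋂ j, F j = ∅ := by
    refine Set.eq_empty_iff_forall_notMem.mpr fun a ha => ?_
    rw [Set.mem_iInter] at ha
    have ha1 : a = 1 := hfaith a fun j => (ha j).1
    obtain ⟨j⟩ := ‹Nonempty J›
    exact (ha j).2 (ha1 ▸ h1V)
  -- hence one of them is empty
  by_contra hne
  push Not at hne
  have hFne : ∀ j, (F j).Nonempty := by
    intro j
    obtain ⟨e, he, heU⟩ := hne j
    exact ⟨aug e, ⟨e, he, rfl⟩, fun hV => heU (hVU hV)⟩
  exact Set.nonempty_iff_ne_empty.mp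
    (IsCompact.nonempty_iInter_of_directed_nonempty_isCompact_isClosed F hFdir hFne hFc hFcl) hFempty

/-- **Conversely, `hcof` implies pro-faithfulness** (`Π_A` T₁): an element of every image `aug (K j)` lies in
every neighbourhood of `1`, hence is `1`. [cite: MochizukiSemiAnbd2006, Thm 5.4 (i) p.66] -/
theorem forall_mem_map_imp_eq_one_of_cofinal_map [T1Space PA]
    (hcof : ∀ U ∈ 𝓝 (1 : PA), ∃ j, ∀ e ∈ K j, aug e ∈ U) :
    ∀ a : PA, (∀ j, a ∈ (K j).map aug) → a = 1 := by
  intro a ha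
  by_contra hne
  obtain ⟨j, hj⟩ := hcof {a}ᶜ (isOpen_compl_singleton.mem_nhds fun h => hne (Set.mem_singleton_iff.mp h).symm)
  obtain ⟨e, he, rfl⟩ := ha j
  exact hj e he rfl

/-- The image of an OPEN subgroup under an OPEN homomorphism is closed (open subgroups of topological groups
are closed). [cite: MochizukiSemiAnbd2006, Thm 5.4 (i) p.66] -/
theorem isClosed_map_of_isOpen [TopologicalSpace E] [IsTopologicalGroup PA] (haug : IsOpenMap aug)
    {L : Subgroup E} (hL : IsOpen (L : Set E)) : IsClosed ((L.map aug : Subgroup PA) : Set PA) := by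
  have hopen : IsOpen ((L.map aug : Subgroup PA) : Set PA) := by
    rw [Subgroup.coe_map]
    exact haug _ hL
  exact OpenSubgroup.isClosed ⟨L.map aug, hopen⟩

end Generic

/-! ### In the currency of the (AI4″) producer: `levelAct j : E →* Aut (𝔾_j)` -/

section Levels

variable {E : Type u} [Group E] [TopologicalSpace E] {PA : Type u} [Group PA] [TopologicalSpace PA]
  [IsTopologicalGroup PA] (aug : E →* PA)
  {J : Type v} (level : J → SemiGraph.{u}) (levelAct : ∀ j, E →* CategoryTheory.Aut (level j))

/-- **`hcof` of abc-iut-w4-d029's `CompactCompletionFaithful` / abc-iut-w4-d059's (AI4″) producer, VERBATIM,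
from pro-faithfulness**: for compact `Π_A`, open level kernels (`hopen`, the capstone's `hKopen`), an open
`aug` (abc-iut-L3-d2's tempered topology: `aug` is an open surjection) and a downward-directed family of
levels, if no `a ≠ 1` of `Π_A` has at EVERY level a lift acting trivially on that level's semi-graph
(`hfaith`), then `∀ U ∈ 𝓝 1, ∃ j, ∀ e ∈ ker (levelAct j), aug e ∈ U`.
[cite: MochizukiSemiAnbd2006, Thm 5.4 (i) p.66] -/
theorem hcof_of_faithful_levels [CompactSpace PA] [Nonempty J]
    (hdir : ∀ i j, ∃ k, (levelAct k).ker ≤ (levelAct i).ker ∧ (levelAct k).ker ≤ (levelAct j).ker)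
    (hopen : ∀ j, IsOpen ((levelAct j).ker : Set E)) (haug : IsOpenMap aug)
    (hfaith : ∀ a : PA, (∀ j, a ∈ ((levelAct j).ker).map aug) → a = 1) :
    ∀ U ∈ 𝓝 (1 : PA), ∃ j, ∀ e ∈ (levelAct j).ker, aug e ∈ U :=
  cofinal_map_of_forall_mem_map_imp_eq_one aug (fun j => (levelAct j).ker) hdir
    (fun j => isClosed_map_of_isOpen aug haug (hopen j)) hfaith

omit [TopologicalSpace E] [IsTopologicalGroup PA] in
/-- **The converse**: `hcof` forces pro-faithfulness of `Π_A` on the tower of level graphs (`Π_A` T₁) — so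
the capstone's binder `hcof` and `hfaith` are EQUIVALENT under its side conditions.
[cite: MochizukiSemiAnbd2006, Thm 5.4 (i) p.66] -/
theorem faithful_levels_of_hcof [T1Space PA]
    (hcof : ∀ U ∈ 𝓝 (1 : PA), ∃ j, ∀ e ∈ (levelAct j).ker, aug e ∈ U) :
    ∀ a : PA, (∀ j, a ∈ ((levelAct j).ker).map aug) → a = 1 :=
  forall_mem_map_imp_eq_one_of_cofinal_map aug (fun j => (levelAct j).ker) hcof

/-- Over `ℕ`-indexed ANTITONE levels (the capstone's `hL`), directedness is automatic.
[cite: MochizukiSemiAnbd2006, Thm 5.4 (i) p.66] -/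
theorem hcof_of_faithful_levels_nat [CompactSpace PA] (level : ℕ → SemiGraph.{u})
    (levelAct : ∀ j, E →* CategoryTheory.Aut (level j))
    (hanti : ∀ ⦃i j : ℕ⦄, i ≤ j → (levelAct j).ker ≤ (levelAct i).ker)
    (hopen : ∀ j, IsOpen ((levelAct j).ker : Set E)) (haug : IsOpenMap aug)
    (hfaith : ∀ a : PA, (∀ j, a ∈ ((levelAct j).ker).map aug) → a = 1) :
    ∀ U ∈ 𝓝 (1 : PA), ∃ j, ∀ e ∈ (levelAct j).ker, aug e ∈ U :=
  hcof_of_faithful_levels aug level levelAct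
    (fun i j => ⟨max i j, hanti (le_max_left i j), hanti (le_max_right i j)⟩) hopen haug hfaith

end Levels

end Literature.AnabelianGeometry.SemiGraphs
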